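import Summits.NavierStokesRegularity.NavierStokesRegularity.Theorems.SoloSalvageWu2026PressureCompactHarmonic
import Summits.NavierStokesRegularity.NavierStokesRegularity.Theorems.SoloSalvageWu2026PressureCompactGlue
import Literature.Analysis.FunctionSpaces.DiagonalWeakLimits
import HarnessLib

/-!
# C177 `Wu2026` — `Step_construct` sub-binder (B) HOLDS: pressure compactness (3.45),
# `P_j → P` in `L²_loc(ℝ³ ∖ {0})` along a subsequence

Seat `ns-in-wu-341` on sub-binder (B) of `step_construct_of_pieces` (`SoloSalvageWu2026Construct`,
seat `ns-in-wu-con`; cut owner `ns-inputs-plan` g5 ruling 07:43Z: «wu-341 TAKES sub-binder (B) =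
hypothesis (B) VERBATIM … name the final theorem `step_construct_pieceB`»). Salvage conventions:
theorems only, standard axioms, no definition, no named fact; `--supports` item 0897.

Print (arXiv:2608.22471v1, p.15 l.17 – p.16 l.27): local split `P_j = L_j + H_j`, `L_j → L` by
Calderón–Zygmund, `H_j` harmonic and bounded, «By Arzelà–Ascoli, followed by a diagonal argument
over both m and a nested exhaustion of R³∖{0}, we may pass to a subsequence such that H_j
converges … Consequently, there is a function P such that P_j → P strongly in
L^{q₀/2}_loc(R³∖{0}). (3.45)» (`q₀ = 4`).

Formalisation (the four preceding `…PressureCompact*` files of this seat supply the pieces):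
* `exists_cutoff_two_three` — a smooth cut-off `= 1` on `B(c, 2r)`, supported in `B̄(c, 3r)`;
* `exists_subseq_ball_limits` — for a sequence of good balls: ONE diagonal extraction
  (`exists_strictMono_forall_tendsto_real` over the countable index `k × (dense point)`) makes every
  Weyl representative `H'_{k,φ(j)}` (of `SoloSalvageWu2026PressureCompactHarmonic`) converge on a
  dense set, hence everywhere (`forall_exists_tendsto_of_subset_closure`, equi-Lipschitz), hence
  `P_{φ(j)} → p̃[χ_kV] + h_k` in `L²(B(c_k, r_k))` (`tendsto_setLIntegral_sq_of_split` with the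
  `L²` convergence of the local Riesz parts, `tendsto_eLpNorm_localRiesz_sub`);
* `step_construct_pieceB` — hypothesis (B) of `step_construct_of_pieces`, verbatim: good-ball cover
  (`exists_goodBalls`), the ball-wise limits, the gluing `exists_glued_limit`, and the passage from
  `∫⁻ ‖·‖ₑ²` to the skeleton's `∫ |·|^{4/2}`.

WHAT THIS IS NOT: not a proof of `Step_construct` (pieces (A), (E) remain with `ns-in-wu-con`); not
a claim about NS regularity or blow-up; not a claim about any author beyond the typed locator.
-/

noncomputable section

set_option linter.dupNamespace false

open MeasureTheory Set Function Filter Topology Metric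
open scoped ENNReal NNReal RealInnerProductSpace ContDiff

namespace Summit.NavierStokesRegularity.NavierStokesRegularity.Theorems.Wu2026Salvage

open Literature.Claims.NS.Wu2026 Literature.Analysis.FluidPDE Literature.Analysis.FunctionSpaces

-- nested operator types in the imported pressure files
set_option maxSynthPendingDepth 3

/-- **A smooth cut-off of a ball**: `χ ∈ C_c^∞`, `|χ| ≤ 1`, `χ = 1` on `B(c₀, 2r)`,
`tsupport χ ⊆ B̄(c₀, 3r)` (Mathlib's `ContDiffBump`). [folklore] -/
theorem exists_cutoff_two_three (c₀ : E3) {r : ℝ} (hr : 0 < r) :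
    ∃ χ : E3 → ℝ, ContDiff ℝ ∞ χ ∧ HasCompactSupport χ ∧ (∀ y, |χ y| ≤ 1) ∧
      (∀ y ∈ ball c₀ (2 * r), χ y = 1) ∧ tsupport χ ⊆ closedBall c₀ (3 * r) := by
  let b : ContDiffBump c₀ := ⟨2 * r, 3 * r, by linarith, by linarith⟩
  refine ⟨b, b.contDiff, b.hasCompactSupport, fun y => ?_, fun y hy => ?_, ?_⟩
  · rw [abs_le]
    exact ⟨by linarith [b.nonneg (x := y)], b.le_one⟩
  · exact b.one_of_mem_closedBall (ball_subset_closedBall hy)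
  · rw [b.tsupport_eq]

/-- **Ball-wise limits along one subsequence** (p.15 l.33 – p.16 l.8: «The interior estimates for
harmonic functions … By Arzelà–Ascoli, followed by a diagonal argument …»): for an `IsWuFlow` with
`v ∈ L^{9/2,∞}`, the constant `c` with `p − c ∈ L^{9/4,∞}`, scales `R_j = 2^{n_j}`, a blow-down
velocity limit `V` in `L⁴_loc(ℝ³∖{0})` and balls `B(c_k, r_k)` with `B̄(c_k, 3r_k) ⊆ ℝ³∖{0}`, there are
a subsequence `φ` and measurable `P^{(k)}` with `∫_{B(c_k,r_k)} |P^{(k)}|² < ∞` and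
`∫_{B(c_k,r_k)} |P_{φ(j)} − P^{(k)}|² → 0` for every `k`. [cite: Wu2026, p.15 l.33 – p.16 l.8] -/
theorem exists_subseq_ball_limits {ν : ℝ} {v : E3 → E3} {p : E3 → ℝ} (hf : IsWuFlow ν v p)
    (hvw : MemWeakLp v ((9 : ℝ≥0∞) / 2) volume) {c : ℝ}
    (hpc : MemWeakLp (fun x => p x - c) ((9 : ℝ≥0∞) / 4) volume) {n : ℕ → ℕ} {V : E3 → E3}
    (hVm : AEStronglyMeasurable V volume)
    (hVint : ∀ K : Set E3, IsCompact K → K ⊆ punctured →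
      IntegrableOn (fun y => ‖V y‖ ^ (4 : ℝ)) K)
    (hVconv : ∀ K : Set E3, IsCompact K → K ⊆ punctured →
      Tendsto (fun j => ∫ y in K, ‖blowDown ((2 : ℝ) ^ n j) v y - V y‖ ^ (4 : ℝ)) atTop (𝓝 0))
    {ctr : ℕ → E3} {rad : ℕ → ℝ} (hrad : ∀ k, 0 < rad k)
    (hsub : ∀ k, closedBall (ctr k) (3 * rad k) ⊆ punctured) :
    ∃ φ : ℕ → ℕ, StrictMono φ ∧ ∃ Plim : ℕ → E3 → ℝ, (∀ k, AEStronglyMeasurable (Plim k) volume) ∧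
      (∀ k, ∫⁻ y in ball (ctr k) (rad k), ‖Plim k y‖ₑ ^ (2 : ℝ) < ⊤) ∧
      ∀ k, Tendsto (fun j => ∫⁻ y in ball (ctr k) (rad k),
        ‖blowDownP ((2 : ℝ) ^ n (φ j)) (fun x => p x - c) y - Plim k y‖ₑ ^ (2 : ℝ)) atTop (𝓝 0) := by
  have h2_1 : (1 : ℝ≥0∞) < 2 := by norm_num
  have h2_t : (2 : ℝ≥0∞) < ⊤ := ENNReal.ofNat_lt_top
  have h22_0 : (2 * 2 : ℝ≥0∞) ≠ 0 := by norm_num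
  have h22_t : (2 * 2 : ℝ≥0∞) ≠ ⊤ := by norm_num
  have h22_r : (2 * 2 : ℝ≥0∞).toReal = 4 := by norm_num
  set R : ℕ → ℝ := fun j => (2 : ℝ) ^ n j with hRdef
  have hR : ∀ j, 0 < R j := fun j => pow_pos two_pos _
  -- cut-offs
  choose χ hχs hχc hχ01 hχ1 hχS using fun k => exists_cutoff_two_three (ctr k) (hrad k)
  have hSc : ∀ k, IsCompact (closedBall (ctr k) (3 * rad k)) := fun k => isCompact_closedBall _ _
  -- Weyl representatives of the harmonic parts, bounds uniform in the scale
  have hrep := fun k =>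
    exists_forall_harmonicPart_rep hf hvw hpc (hχs k) (hχc k) (hχ01 k) (ctr k) (hrad k) (hχ1 k)
  choose B hB0 hB using hrep
  choose H hHbd hHlip hHae using hB
  have hHcont : ∀ k j, Continuous (H k (R j) (hR j)) := fun k j =>
    (LipschitzWith.of_dist_le_mul (K := ⟨B k, hB0 k⟩) fun y z => by
      rw [Real.dist_eq, dist_eq_norm]; exact hHlip k _ _ y z).continuous
  -- one diagonal extraction over `k × (dense point)`
  obtain ⟨D, hDc, hDd⟩ := TopologicalSpace.exists_countable_dense E3
  haveI : Countable D := hDc.to_subtype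
  obtain ⟨φ, hφ, hlimD⟩ := exists_strictMono_forall_tendsto_real
    (fun j (q : ℕ × D) => H q.1 (R j) (hR j) (q.2 : E3)) (fun q => ⟨B q.1, fun j => hHbd q.1 _ _ _⟩)
  -- pointwise convergence everywhere, by equi-Lipschitz continuity
  have hext : ∀ k (t : E3), ∃ l, Tendsto (fun j => H k (R (φ j)) (hR (φ j)) t) atTop (𝓝 l) := by
    intro k
    have h := forall_exists_tendsto_of_subset_closure (F := ℝ)
      (x := fun j t => H k (R (φ j)) (hR (φ j)) t) (S := univ) (D := D)
      (by rw [hDd.closure_eq]) (fun d hd => hlimD (k, ⟨d, hd⟩)) ?_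
    · exact fun t => h t (mem_univ t)
    · intro ε hε
      refine ⟨ε / (B k + 1), div_pos hε (by linarith [hB0 k]), fun j t _ d _ htd => ?_⟩
      rw [Real.dist_eq]
      calc |H k (R (φ j)) (hR (φ j)) t - H k (R (φ j)) (hR (φ j)) d| ≤ B k * ‖t - d‖ :=
            hHlip k _ _ t d
        _ = B k * dist t d := by rw [dist_eq_norm]
        _ ≤ B k * (ε / (B k + 1)) := mul_le_mul_of_nonneg_left htd.le (hB0 k)
        _ < ε := by
            rw [mul_div_assoc', div_lt_iff₀ (by linarith [hB0 k])]
            nlinarith [hB0 k]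
  choose hfun hpt using hext
  have hhm : ∀ k, AEStronglyMeasurable (hfun k) volume := fun k =>
    aestronglyMeasurable_of_tendsto_ae atTop (fun j => (hHcont k (φ j)).aestronglyMeasurable)
      (Eventually.of_forall (hpt k))
  have hhB : ∀ k y, |hfun k y| ≤ B k := fun k =>
    abs_le_of_tendsto_of_abs_le (fun j y => hHbd k _ _ y) (hpt k)
  -- the local Riesz parts converge (along the whole sequence, hence along `φ`)
  have hVS : ∀ k, IntegrableOn (fun y => ‖V y‖ ^ (4 : ℝ)) (closedBall (ctr k) (3 * rad k)) volume :=
    fun k => hVint _ (hSc k) (hsub k)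
  have hL : ∀ k, Tendsto (fun j => eLpNorm (fun y =>
      normalisedPressure (fun y => χ k y • blowDown (R (φ j)) v y) y -
        normalisedPressure (fun y => χ k y • V y) y) 2 volume) atTop (𝓝 0) := fun k =>
    (tendsto_eLpNorm_localRiesz_sub (Rj := R) hf.smooth_v.continuous (hχs k).continuous (hχc k)
      (hχ01 k) (hSc k) (hχS k) hVm (hVS k) (hVconv _ (hSc k) (hsub k))).comp hφ.tendsto_atTop
  -- the limits `P^{(k)} = p̃[χ_k V] + h_k`
  have hχV : ∀ k, MemLp (fun y => χ k y • V y) (2 * 2) volume := fun k => by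
    refine ⟨(hχs k).continuous.aestronglyMeasurable.smul hVm, ?_⟩
    rw [eLpNorm_lt_top_iff_lintegral_rpow_enorm_lt_top h22_0 h22_t, h22_r]
    exact (lintegral_cutoff_smul_rpow_four_le (hχ01 k) (hSc k).measurableSet (hχS k) V).trans_lt
      (lintegral_enorm_rpow_lt_top_of_integrableOn (by norm_num) (hVS k))
  have hLlim : ∀ k, MemLp (normalisedPressure (fun y => χ k y • V y)) 2 volume := fun k =>
    memLp_normalisedPressure_of_memLp_two_mul h2_1 h2_t (hχV k)
  refine ⟨φ, hφ, fun k y => normalisedPressure (fun y => χ k y • V y) y + hfun k y,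
    fun k => (hLlim k).1.add (hhm k), fun k => ?_, fun k => ?_⟩
  · -- `∫_{B_k} |P^{(k)}|² < ∞`
    have hle : ∀ y, ‖normalisedPressure (fun y => χ k y • V y) y + hfun k y‖ₑ ^ (2 : ℝ) ≤
        2 * (‖normalisedPressure (fun y => χ k y • V y) y‖ₑ ^ (2 : ℝ) +
          ENNReal.ofReal (B k ^ (2 : ℝ))) := by
      intro y
      have hh : ‖hfun k y‖ₑ ^ (2 : ℝ) ≤ ENNReal.ofReal (B k ^ (2 : ℝ)) := by
        rw [← ofReal_norm_rpow _ (by norm_num)]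
        refine ENNReal.ofReal_le_ofReal (Real.rpow_le_rpow (norm_nonneg _) ?_ (by norm_num))
        rw [Real.norm_eq_abs]; exact hhB k y
      calc ‖normalisedPressure (fun y => χ k y • V y) y + hfun k y‖ₑ ^ (2 : ℝ)
          ≤ (‖normalisedPressure (fun y => χ k y • V y) y‖ₑ + ‖hfun k y‖ₑ) ^ (2 : ℝ) :=
            ENNReal.rpow_le_rpow (enorm_add_le _ _) (by norm_num)
        _ ≤ (2 : ℝ≥0∞) ^ ((2 : ℝ) - 1) * (‖normalisedPressure (fun y => χ k y • V y) y‖ₑ ^ (2 : ℝ) +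
              ‖hfun k y‖ₑ ^ (2 : ℝ)) := ENNReal.rpow_add_le_mul_rpow_add_rpow _ _ (by norm_num)
        _ ≤ 2 * (‖normalisedPressure (fun y => χ k y • V y) y‖ₑ ^ (2 : ℝ) +
              ENNReal.ofReal (B k ^ (2 : ℝ))) := by
            have h21 : (2 : ℝ≥0∞) ^ ((2 : ℝ) - 1) = 2 := by norm_num
            rw [h21]
            exact mul_le_mul' le_rfl (add_le_add le_rfl hh)
    have hglob : ∫⁻ y, ‖normalisedPressure (fun y => χ k y • V y) y‖ₑ ^ (2 : ℝ) < ⊤ := by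
      have h := lintegral_rpow_enorm_lt_top_of_eLpNorm_lt_top (by norm_num) ENNReal.ofNat_ne_top
        (hLlim k).2
      rwa [ENNReal.toReal_ofNat] at h
    have hmeas : AEMeasurable (fun y => ‖normalisedPressure (fun y => χ k y • V y) y‖ₑ ^ (2 : ℝ))
        (volume.restrict (ball (ctr k) (rad k))) := ((hLlim k).1.enorm.pow_const _).restrict
    calc ∫⁻ y in ball (ctr k) (rad k), ‖normalisedPressure (fun y => χ k y • V y) y + hfun k y‖ₑ ^ (2 : ℝ)
        ≤ ∫⁻ y in ball (ctr k) (rad k), 2 * (‖normalisedPressure (fun y => χ k y • V y) y‖ₑ ^ (2 : ℝ) +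
            ENNReal.ofReal (B k ^ (2 : ℝ))) := lintegral_mono hle
      _ = 2 * ((∫⁻ y in ball (ctr k) (rad k), ‖normalisedPressure (fun y => χ k y • V y) y‖ₑ ^ (2 : ℝ)) +
            ENNReal.ofReal (B k ^ (2 : ℝ)) * volume (ball (ctr k) (rad k))) := by
          rw [lintegral_const_mul' _ _ ENNReal.ofNat_ne_top, lintegral_add_left' hmeas,
            setLIntegral_const]
      _ < ⊤ := by
          refine ENNReal.mul_lt_top ENNReal.ofNat_lt_top (ENNReal.add_lt_top.2 ⟨?_, ?_⟩)
          · exact (lintegral_mono_set (subset_univ _)).trans_lt (by rwa [Measure.restrict_univ])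
          · exact ENNReal.mul_lt_top ENNReal.ofReal_lt_top measure_ball_lt_top
  · -- `∫_{B_k} |P_{φ(j)} − P^{(k)}|² → 0`
    exact tendsto_setLIntegral_sq_of_split (A := ball (ctr k) (rad k))
      (Pj := fun j => blowDownP (R (φ j)) (fun x => p x - c))
      (Lj := fun j => normalisedPressure (fun y => χ k y • blowDown (R (φ j)) v y))
      (Hrep := fun j => H k (R (φ j)) (hR (φ j)))
      (L := normalisedPressure (fun y => χ k y • V y)) (h := hfun k) measure_ball_lt_top
      (fun j => (contDiff_localRiesz hf.smooth_v (hχs k) (hχc k) _).continuous.aestronglyMeasurable)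
      (hLlim k).1 (fun j => (hHcont k (φ j)).aestronglyMeasurable)
      (fun j => hHae k (R (φ j)) (hR (φ j))) (hL k) (fun j y => hHbd k _ _ y) (hpt k)

/-- **Sub-binder (B) of `Step_construct` — pressure compactness (3.45)**: hypothesis (B) of
`step_construct_of_pieces`, verbatim. «Passing to a further subsequence, P_j → P strongly in
L^{q₀/2}_loc(R³∖{0}) (3.45)» with `q₀ = 4`: along a subsequence of the given scales, the rescaled
canonical pressures `P_j = R_j^{4/3}(p − c)(R_j·)` converge in `L²(K)` for every compact
`K ⊆ ℝ³∖{0}` to one measurable `P`, locally square integrable on `ℝ³∖{0}`. The annular bound (3.18)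
and the Bernoulli bound of the hypotheses are not used. [cite: Wu2026, (3.45) p.16 l.21–27; p.15 l.17 – p.16 l.8] -/
theorem step_construct_pieceB : ∀ ν : ℝ, 0 < ν → ∀ (v : E3 → E3) (p : E3 → ℝ), IsWuFlow ν v p →
      MemWeakLp v ((9 : ℝ≥0∞) / 2) volume →
      (∀ q : ℝ, 1 < q → q < 9 / 2 → ∃ C : ℝ, ∀ R : ℝ, 0 < R →
        IntegrableOn (fun x => ‖v x‖ ^ q) (annulus R) ∧
        (∫ x in annulus R, ‖v x‖ ^ q) ^ (1 / q) ≤ C * R ^ (-(2 : ℝ) / 3 + 3 / q)) →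
      ∀ c : ℝ, MemWeakLp (fun x => p x - c) ((9 : ℝ≥0∞) / 4) volume →
        MemWeakLp (bern v (fun x => p x - c)) ((9 : ℝ≥0∞) / 4) volume →
      ∀ n : ℕ → ℕ, Tendsto n atTop atTop →
      ∀ V : E3 → E3, AEStronglyMeasurable V volume →
        (∀ K : Set E3, IsCompact K → K ⊆ punctured →
          IntegrableOn (fun y => ‖V y‖ ^ (4 : ℝ)) K) →
        (∀ K : Set E3, IsCompact K → K ⊆ punctured →
          Tendsto (fun j => ∫ y in K, ‖blowDown ((2 : ℝ) ^ n j) v y - V y‖ ^ (4 : ℝ))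
            atTop (𝓝 0)) →
      ∃ σ : ℕ → ℕ, StrictMono σ ∧ ∃ P : E3 → ℝ, AEStronglyMeasurable P volume ∧
        (∀ K : Set E3, IsCompact K → K ⊆ punctured →
          IntegrableOn (fun y => |P y| ^ ((4 : ℝ) / 2)) K) ∧
        (∀ K : Set E3, IsCompact K → K ⊆ punctured →
          Tendsto (fun j => ∫ y in K,
            |blowDownP ((2 : ℝ) ^ n (σ j)) (fun x => p x - c) y - P y| ^ ((4 : ℝ) / 2))
            atTop (𝓝 0)) := by
  intro ν _hν v p hf hvw _h318 c hpc _hbern n _hn V hVm hVint hVconv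
  obtain ⟨ctr, rad, hrad, hsub, hcov⟩ := exists_goodBalls
  obtain ⟨φ, hφ, Plim, hPlm, hfin, hconvk⟩ :=
    exists_subseq_ball_limits hf hvw hpc hVm hVint hVconv hrad hsub
  have hPc : Continuous fun x => p x - c := hf.smooth_p.continuous.sub continuous_const
  have hPjm : ∀ j, AEStronglyMeasurable (blowDownP ((2 : ℝ) ^ n (φ j)) (fun x => p x - c)) volume :=
    fun j => (continuous_blowDownP hPc _).aestronglyMeasurable
  obtain ⟨P, hPm, hP⟩ := exists_glued_limit
    (Pj := fun j => blowDownP ((2 : ℝ) ^ n (φ j)) (fun x => p x - c)) hPjm hcov hPlm hfin hconvk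
  have h42 : (4 : ℝ) / 2 = 2 := by norm_num
  refine ⟨φ, hφ, P, hPm, fun K hK hKp => ?_, fun K hK hKp => ?_⟩
  · -- local square integrability
    obtain ⟨hfinK, -⟩ := hP K hK hKp
    have hmem : MemLp P 2 (volume.restrict K) := by
      refine ⟨hPm.restrict, ?_⟩
      rw [eLpNorm_lt_top_iff_lintegral_rpow_enorm_lt_top (by norm_num) ENNReal.ofNat_ne_top,
        ENNReal.toReal_ofNat]
      exact hfinK
    have hint := hmem.integrable_norm_rpow (by norm_num) ENNReal.ofNat_ne_top
    rw [ENNReal.toReal_ofNat] at hint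
    refine hint.congr (Eventually.of_forall fun y => ?_)
    show ‖P y‖ ^ (2 : ℝ) = |P y| ^ ((4 : ℝ) / 2)
    rw [h42, Real.norm_eq_abs]
  · -- convergence in the skeleton's form
    obtain ⟨-, hconvK⟩ := hP K hK hKp
    have hfun_eq : ∀ j, (fun y => |blowDownP ((2 : ℝ) ^ n (φ j)) (fun x => p x - c) y - P y| ^ ((4 : ℝ) / 2)) =
        fun y => (blowDownP ((2 : ℝ) ^ n (φ j)) (fun x => p x - c) y - P y) ^ 2 := fun j => by
      funext y; rw [h42, Real.rpow_two, sq_abs]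
    have heq : ∀ j, ∫ y in K, |blowDownP ((2 : ℝ) ^ n (φ j)) (fun x => p x - c) y - P y| ^ ((4 : ℝ) / 2) =
        (∫⁻ y in K, ‖blowDownP ((2 : ℝ) ^ n (φ j)) (fun x => p x - c) y - P y‖ₑ ^ (2 : ℝ)).toReal := by
      intro j
      have h1 : AEStronglyMeasurable
          (fun y => blowDownP ((2 : ℝ) ^ n (φ j)) (fun x => p x - c) y - P y) volume := (hPjm j).sub hPm
      rw [hfun_eq j, integral_eq_lintegral_of_nonneg_ae (Eventually.of_forall fun y => sq_nonneg _)
        (h1.pow 2).restrict]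
      congr 1
      refine lintegral_congr fun y => ?_
      rw [← ofReal_norm_rpow _ (by norm_num : (0 : ℝ) ≤ 2), Real.rpow_two, Real.norm_eq_abs, sq_abs]
    simp_rw [heq]
    have h0 := (ENNReal.tendsto_toReal ENNReal.zero_ne_top).comp hconvK
    rwa [ENNReal.toReal_zero] at h0

end Summit.NavierStokesRegularity.NavierStokesRegularity.Theorems.Wu2026Salvage

end

-- WHAT THIS IS NOT: not a claim about NS regularity or blow-up; not a claim about any author beyond the typed locator.
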